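import Literature.Barriers.RiemannHypothesis.EpsteinZetaRealZerosDHTwist
import Literature.Barriers.RiemannHypothesis.EpsteinZetaRealZerosDHVocabulary
import Literature.NumberTheory.QuadraticFields.IdealClassEpsteinSum
import Literature.NumberTheory.LFunctions.RayClassLogEuler
import HarnessLib

/-!
# Davenport–Heilbronn for Epstein zeta functions, III: the twisted model of a form as a combination
# of twisted class-character `L`-series

Sibling of `Literature/Barriers/RiemannHypothesis/EpsteinZetaRealZeros.lean` (named fact
`DavenportHeilbronn1936b_epstein`). Everything in this file is PROVED; no definitions, no named facts.
It is the bridge from the FORM side of the Davenport–Heilbronn method (the twisted model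
`Z_a(s) = Σ'_v a(Q(v)) Q(v)^{-s}` of `EpsteinZetaRealZerosDHTwist.lean`) to its IDEAL side (the twisted
class-character series `M(s, χ) = ∑_𝔞 χ(𝔞) a(N𝔞) N𝔞^{-s}` of `EpsteinZetaRealZerosDHVocabulary.lean`),
Davenport–Heilbronn I §4 and II §2:

> "It is well known that the various non-equivalent quadratic forms of discriminant `d` correspond
> (1, 1) to the classes `𝔎` of ideals in the quadratic field `P(√d)` in such a way that the number of
> representations of a positive integer `n` by the quadratic form is precisely twice the number of
> integer ideals of norm `n` in the corresponding class. Hence, if `𝔎₁` is the class corresponding to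
> `Q`, `ζ(s, Q) = 2 ∑_{𝔞 in 𝔎₁} N𝔞^{-s}`. Let `χ` run through the characters of the group of ideal
> classes … Then `ζ(s, Q) = (2/h(d)) ∑_χ χ̄(𝔎₁) L(s, χ)`" (I §4); "`M(s, χ) = ∑ a(n)χ(n) n^{-s} =
> ∏_p {1 − a(p)χ(p) p^{-s}}⁻¹`" (I §2, for the twisted series).

For an imaginary quadratic field `K` with `d_K < −4` (so that the units are `±1`), an integral basis
`(1, ω)`, `ω² = m + tω`, and the lattice ideal `𝔟 = (A, ω − k)` of a form `(A, t − 2k, C)` of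
discriminant `d_K` (`A > 0`, `AC = k² − tk − m`, the dictionary of `FormIdeals.lean` /
`IdealClassEpsteinSum.lean`), we prove, for a completely multiplicative `a : ℕ →* ℂ` with `|a| ≤ 1`
and real `s > 1`:

* `tsum_ideal_mul_isPrincipal_eq_half_twistModel` — the twisted class-sum identity
  `∑_{𝔞 : 𝔟𝔞 principal} a(N𝔞) N𝔞^{-s} = ½ Z_a(s)` (the tree's
  `tsum_ideal_mul_isPrincipal_eq_half_twistZeta`, there for Dirichlet-character weights, redone for an
  arbitrary bounded weight `a ∘ N`);
* `tsum_indicator_idealClass_eq_sum_addChar` — orthogonality: a sum over the ideals of one class is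
  `(1/h) ∑_χ χ(·)⁻¹ ×` the character-twisted sum over all ideals;
* `rayClassLSeries_twistCoeff_eq_tsum`, `cexp_logEuler_twistCoeff` — `M(s, χ)` is the tree's
  `rayClassLSeries ⊤ (twistCoeff χ a)`, with Euler product `exp E_χ(s)`, `E_χ = logEuler (twistCoeff χ a)`;
* `twistModel_eq_sum_addChar` — **the bridge**:
  `Z_a(s) = (2/h) ∑_χ χ([𝔟]) · exp E_χ(s)` (the class of the form is `[𝔟]⁻¹`, and `χ([𝔟]⁻¹)⁻¹ = χ([𝔟])`).

## References

* [DavenportHeilbronn1936a] H. Davenport, H. Heilbronn, *On the zeros of certain Dirichlet series I*,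
  J. London Math. Soc. 11 (1936), 181–185, §2 and §4.
* [DavenportHeilbronn1936b] — *II*, ibid. 307–312, §2.
* [Cox2013] D. A. Cox, *Primes of the form x² + ny²*, 2nd ed. (2013), §7.B Thm. 7.7 (the dictionary).
-/

noncomputable section

open Filter Topology Complex Module NumberField Ideal IsDedekindDomain
open Literature.NumberTheory.LFunctions Literature.NumberTheory.LFunctions.AbelianDensity
open Literature.NumberTheory.QuadraticFields.BakerLimitFormula
open Literature.NumberTheory.QuadraticFields.Quadratic
open scoped nonZeroDivisors

namespace Literature.Barriers.RiemannHypothesis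

namespace DHEpstein

variable {K : Type*} [Field K] [NumberField K]

/-! ## The twisted class-sum identity -/

/-- **The twisted partial zeta function of the class `[𝔟]⁻¹` is half the twisted model.** Let `K`
be an imaginary quadratic field (any number field with an integral basis `(1, ω)`, `ω² = m + tω`,
`t² + 4m < −4`), `𝔟 = (A, ω − k)` with `A > 0`, `AC = k² − tk − m`, `w : ℕ → ℂ` a weight with
`|w| ≤ 1` and `Re s > 1`. Then `∑_{𝔞 : 𝔟𝔞 principal} w(N𝔞) N𝔞^{-s} = ½ Σ'_v w(Q(v)) Q(v)^{-s}`,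
`Q = (A, t − 2k, C)`. (D–H I §4: "the number of representations of `n` by the quadratic form is
precisely twice the number of integer ideals of norm `n` in the corresponding class"; proof as the
tree's `tsum_ideal_mul_isPrincipal_eq_half_twistZeta`: `(x, y) ↦ α = xA + y(ω − k) ∈ 𝔟`,
`α ↦ 𝔞 = (α)𝔟⁻¹` is two-to-one off `0` onto the ideals with `𝔟𝔞` principal, and `N𝔞 = Q(x, y)`.)
[cite: DavenportHeilbronn1936a, §4] [cite: Cox2013, §7.B Thm. 7.7] -/
theorem tsum_ideal_mul_isPrincipal_eq_half_twistModel (b : Basis (Fin 2) ℤ (𝓞 K)) (hb : b 0 = 1)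
    {t m : ℤ} (hω : b 1 * b 1 = (m : 𝓞 K) + (t : 𝓞 K) * b 1) (hD : t ^ 2 + 4 * m < -4)
    {A k C : ℤ} (hA : 0 < A) (hn : A * C = k ^ 2 - t * k - m)
    (w : ℕ → ℂ) (hw : ∀ n, ‖w n‖ ≤ 1) {s : ℂ} (hs : 1 < s.re) :
    ∑' J : {J : Ideal (𝓞 K) // (span {(A : 𝓞 K), b 1 - k} * J).IsPrincipal},
        w (absNorm J.1) * ((absNorm J.1 : ℕ) : ℂ) ^ (-s) =
      1 / 2 * twistModel w A (t - 2 * k) C s := by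
  classical
  have hs0 : s ≠ 0 := fun h => by rw [h, Complex.zero_re] at hs; linarith
  have hD' : t ^ 2 + 4 * m < 0 := by linarith
  have hpos := isPosDefForm_lattice hD' hA hn
  set 𝔟 : Ideal (𝓞 K) := span {(A : 𝓞 K), b 1 - k} with h𝔟
  have h𝔟0 : 𝔟 ≠ 0 := by
    intro h0
    have hmem : (A : 𝓞 K) ∈ 𝔟 := Ideal.subset_span (by simp)
    rw [h0] at hmem
    have h1 : (A : 𝓞 K) = 0 := by simpa using hmem
    exact hA.ne' (intCast_eq_zero_of_basis b hb h1)
  -- (1) the lattice bijection `ℤ² ≃ 𝔟`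
  set φ : ℤ × ℤ → 𝔟 := fun p => ⟨(p.1 : 𝓞 K) * A + (p.2 : 𝓞 K) * (b 1 - k),
    (mem_span_pair_iff_of_basis b hb hω hn _).2 ⟨p.1, p.2, rfl⟩⟩ with hφ
  have hφ_bij : Function.Bijective φ := by
    constructor
    · intro p q hpq
      have h := congrArg Subtype.val hpq
      simp only [hφ] at h
      obtain ⟨h1, h2⟩ := lattice_coords_unique b hb hA.ne' h
      exact Prod.ext h1 h2
    · rintro ⟨x, hx⟩
      obtain ⟨u, v, rfl⟩ := (mem_span_pair_iff_of_basis b hb hω hn x).1 hx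
      exact ⟨(u, v), rfl⟩
  set e : ℤ × ℤ ≃ 𝔟 := Equiv.ofBijective φ hφ_bij with he
  have he_apply : ∀ p : ℤ × ℤ, ((e p : 𝔟) : 𝓞 K) = (p.1 : 𝓞 K) * A + (p.2 : 𝓞 K) * (b 1 - k) :=
    fun p => rfl
  -- (2) the cofactor ideal `J(α)`: `(α) = 𝔟 · J(α)`
  have hdvd : ∀ α : 𝔟, 𝔟 ∣ span {(α : 𝓞 K)} := fun α =>
    Ideal.dvd_iff_le.mpr ((Ideal.span_singleton_le_iff_mem _).mpr α.2)
  set Jof : 𝔟 → Ideal (𝓞 K) := fun α => Classical.choose (hdvd α) with hJof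
  have hJof_spec : ∀ α : 𝔟, span {(α : 𝓞 K)} = 𝔟 * Jof α := fun α => Classical.choose_spec (hdvd α)
  have hJof_uniq : ∀ (α : 𝔟) (J : Ideal (𝓞 K)), span {(α : 𝓞 K)} = 𝔟 * J → J = Jof α := by
    intro α J hJ
    have : 𝔟 * J = 𝔟 * Jof α := hJ.symm.trans (hJof_spec α)
    exact mul_left_cancel₀ h𝔟0 this
  -- `J(α) = J(α') ↔ α' = ±α`
  have hJof_eq_iff : ∀ α α' : 𝔟, Jof α = Jof α' ↔ (α' = α ∨ α' = -α) := by
    intro α α'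
    constructor
    · intro h
      have this : span {(α : 𝓞 K)} = span {(α' : 𝓞 K)} := by rw [hJof_spec α, hJof_spec α', h]
      rcases (span_singleton_eq_span_singleton_iff' b hb hω hD _ _).1 this with h' | h'
      · exact Or.inl (Subtype.ext h')
      · refine Or.inr (Subtype.ext ?_)
        rw [Submodule.coe_neg]
        exact h'
    · rintro (rfl | rfl)
      · rfl
      · refine hJof_uniq (-α) (Jof α) ?_
        rw [Submodule.coe_neg, Ideal.span_singleton_neg]
        exact hJof_spec α
  -- the norm of `J(e p)`
  have h𝔟N : absNorm 𝔟 = A.natAbs := absNorm_span_pair_eq b hb hω hn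
  have hnormJ : ∀ p : ℤ × ℤ, ((absNorm (Jof (e p)) : ℕ) : ℤ) = bqfZ A (t - 2 * k) C p := by
    intro p
    have h1 := congrArg absNorm (hJof_spec (e p))
    rw [map_mul, Ideal.absNorm_span_singleton, he_apply, norm_lattice_elt b hb hω hn, h𝔟N] at h1
    have hQ : 0 ≤ bqfZ A (t - 2 * k) C p := by
      by_cases hp : p = 0
      · subst hp; simp [bqfZ]
      · exact le_trans zero_le_one (one_le_bqfZ hpos hp)
    have hQ' : A * p.1 ^ 2 + (t - 2 * k) * p.1 * p.2 + C * p.2 ^ 2 = bqfZ A (t - 2 * k) C p := rfl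
    rw [hQ'] at h1
    have h2 : (A * bqfZ A (t - 2 * k) C p).natAbs = A.natAbs * (bqfZ A (t - 2 * k) C p).natAbs :=
      Int.natAbs_mul _ _
    rw [h2] at h1
    have h3 := Nat.eq_of_mul_eq_mul_left (Int.natAbs_pos.mpr hA.ne') h1
    rw [← h3, Int.natAbs_of_nonneg hQ]
  have hnormJ' : ∀ p : ℤ × ℤ, absNorm (Jof (e p)) = bqfNat A (t - 2 * k) C p := by
    intro p
    have := hnormJ p
    unfold bqfNat
    rw [← this, Int.toNat_natCast]
  -- (3) the summand along `e`
  set G : Ideal (𝓞 K) → ℂ := fun I => w (absNorm I) * ((absNorm I : ℕ) : ℂ) ^ (-s) with hG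
  set F : 𝔟 → ℂ := fun α => G (Jof α) with hF
  have hG_bot : G ⊥ = 0 := by
    simp only [hG, Ideal.absNorm_bot, Nat.cast_zero, Complex.zero_cpow (neg_ne_zero.mpr hs0), mul_zero]
  have hterm : ∀ p : ℤ × ℤ,
      twistTerm (twistWeight w A (t - 2 * k) C) (A : ℝ) ((t - 2 * k : ℤ) : ℝ) (C : ℝ) s p = F (e p) := by
    intro p
    by_cases hp : p = 0
    · subst hp
      have hJ0 : Jof (e 0) = ⊥ := by
        refine (hJof_uniq (e 0) ⊥ ?_).symm
        rw [he_apply]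
        simp
      show twistWeight w A (t - 2 * k) C 0 * epsteinTerm (A : ℝ) ((t - 2 * k : ℤ) : ℝ) (C : ℝ) s 0 =
        G (Jof (e 0))
      rw [hJ0, hG_bot]
      simp [epsteinTerm]
    · show twistWeight w A (t - 2 * k) C p * epsteinTerm (A : ℝ) ((t - 2 * k : ℤ) : ℝ) (C : ℝ) s p =
        G (Jof (e p))
      simp only [hG, twistWeight]
      rw [epsteinTerm_eq_natCast_cpow hpos s hp, hnormJ' p]
  -- (4) the twisted Epstein sum is `Σ_α F(α)`
  have hsumT : Summable (twistTerm (twistWeight w A (t - 2 * k) C) (A : ℝ) ((t - 2 * k : ℤ) : ℝ) (C : ℝ) s) :=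
    (summable_norm_twistTerm hpos (fun p => hw _) hs).of_norm
  have hsumF : Summable F := (e.summable_iff).mp (hsumT.congr fun p => hterm p)
  have hZ : twistModel w A (t - 2 * k) C s = ∑' α : 𝔟, F α := by
    unfold twistModel twistZeta
    rw [← e.tsum_eq F]
    exact tsum_congr hterm
  -- (5) the fibres of `J`: `{±α₀}` over the ideals `I` with `𝔟I` principal, `∅` otherwise
  have hfib := hsumF.hasSum.tsum_fiberwise Jof
  have hinner : ∀ I : Ideal (𝓞 K), (∑' α : ↥(Jof ⁻¹' {I}), F α) =
      Set.indicator {I | (𝔟 * I).IsPrincipal} (fun I => 2 * G I) I := by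
    intro I
    by_cases hI : (𝔟 * I).IsPrincipal
    · rw [Set.indicator_of_mem (show I ∈ {I | (𝔟 * I).IsPrincipal} from hI)]
      obtain ⟨β, hβ⟩ : ∃ β : 𝓞 K, 𝔟 * I = span {β} := ⟨_, hI.span_singleton_generator.symm⟩
      have hβmem : β ∈ 𝔟 := by
        have : β ∈ 𝔟 * I := by rw [hβ]; exact Ideal.mem_span_singleton_self β
        exact Ideal.mul_le_right this
      set α₀ : 𝔟 := ⟨β, hβmem⟩ with hα₀
      have hJα₀ : Jof α₀ = I := (hJof_uniq α₀ I hβ.symm).symm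
      have hset : (Jof ⁻¹' {I}) = {α₀, -α₀} := by
        ext α
        simp only [Set.mem_preimage, Set.mem_singleton_iff, Set.mem_insert_iff]
        rw [← hJα₀, eq_comm, hJof_eq_iff α₀ α]
      rw [tsum_subtype (Jof ⁻¹' {I}) F, hset]
      by_cases hβ0 : β = 0
      · have hI0 : I = ⊥ := by
          have : 𝔟 * I = ⊥ := by rw [hβ, hβ0]; simp
          exact (Ideal.mul_eq_bot.mp this).resolve_left h𝔟0
        have hα00 : α₀ = 0 := Subtype.ext hβ0
        rw [hα00, neg_zero, Set.pair_eq_singleton, tsum_eq_single 0 (fun α hα =>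
          Set.indicator_of_notMem (by simpa using hα) F), Set.indicator_of_mem (Set.mem_singleton _)]
        rw [← hα00]
        show G (Jof α₀) = 2 * G I
        rw [hJα₀, hI0, hG_bot, mul_zero]
      · have hne : α₀ ≠ -α₀ := by
          intro h
          have h' : (β : 𝓞 K) = -β := congrArg Subtype.val h
          have : (2 : 𝓞 K) * β = 0 := by linear_combination h'
          exact hβ0 ((mul_eq_zero.mp this).resolve_left (by norm_num))
        rw [tsum_eq_sum (s := {α₀, -α₀}) (fun α hα => Set.indicator_of_notMem (by simpa using hα) F),
          Finset.sum_pair hne, Set.indicator_of_mem (by simp), Set.indicator_of_mem (by simp)]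
        have hJneg : Jof (-α₀) = I := by
          rw [← (hJof_eq_iff α₀ (-α₀)).2 (Or.inr rfl)]
          exact hJα₀
        have h1 : F α₀ = G I := by
          show G (Jof α₀) = G I
          rw [hJα₀]
        have h2 : F (-α₀) = G I := by
          show G (Jof (-α₀)) = G I
          rw [hJneg]
        rw [h1, h2]
        ring
    · rw [Set.indicator_of_notMem (show I ∉ {I | (𝔟 * I).IsPrincipal} from hI)]
      have hempty : (Jof ⁻¹' {I}) = ∅ := by
        ext α
        simp only [Set.mem_preimage, Set.mem_singleton_iff, Set.mem_empty_iff_false, iff_false]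
        intro h
        apply hI
        rw [← h, ← hJof_spec α]
        exact ⟨⟨α, rfl⟩⟩
      rw [tsum_subtype (Jof ⁻¹' {I}) F, hempty]
      simp
  have hfib' : HasSum (Set.indicator {I | (𝔟 * I).IsPrincipal} (fun I => 2 * G I)) (∑' α : 𝔟, F α) := by
    have hfun : (fun I : Ideal (𝓞 K) => ∑' α : ↥(Jof ⁻¹' {I}), F α) =
        Set.indicator {I | (𝔟 * I).IsPrincipal} (fun I => 2 * G I) := funext hinner
    rw [← hfun]
    exact hfib
  have h2 : (∑' α : 𝔟, F α) =
      2 * ∑' J : {J : Ideal (𝓞 K) // (𝔟 * J).IsPrincipal}, G J.1 := by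
    rw [← hfib'.tsum_eq, ← tsum_subtype, tsum_mul_left]
    rfl
  rw [hZ, h2]
  ring

/-! ## Orthogonality: sums over one ideal class -/

/-- For `J ≠ 0`: `𝔟J` is principal iff `[J] = [𝔟]⁻¹`. [folklore] -/
theorem mul_isPrincipal_iff_idealClass_eq {𝔟 J : Ideal (𝓞 K)} (h𝔟 : 𝔟 ≠ ⊥) (hJ : J ≠ ⊥) :
    (𝔟 * J).IsPrincipal ↔ idealClass J = (idealClass 𝔟)⁻¹ := by
  rw [idealClass_of_ne_bot hJ, idealClass_of_ne_bot h𝔟, ClassGroup.mk0_eq_mk0_inv_iff]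
  constructor
  · intro h
    obtain ⟨x, hx⟩ := h
    refine ⟨x, ?_, by rw [mul_comm]; exact hx⟩
    rintro rfl
    have : 𝔟 * J = ⊥ := by rw [hx]; simp
    exact (mul_ne_zero h𝔟 hJ) this
  · rintro ⟨x, -, hx⟩
    exact ⟨⟨x, by rw [mul_comm]; exact hx⟩⟩

open scoped Classical in
/-- A sum over `{J : 𝔟J principal}` is the sum over all ideals of the indicator of the class
`[𝔟]⁻¹`, for summands vanishing on the zero ideal. [folklore] -/
theorem tsum_subtype_mul_isPrincipal_eq {𝔟 : Ideal (𝓞 K)} (h𝔟 : 𝔟 ≠ ⊥) {G : Ideal (𝓞 K) → ℂ}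
    (hG0 : G ⊥ = 0) :
    ∑' J : {J : Ideal (𝓞 K) // (𝔟 * J).IsPrincipal}, G J.1 =
      ∑' J : Ideal (𝓞 K), if idealClass J = (idealClass 𝔟)⁻¹ then G J else 0 := by
  rw [show (∑' J : {J : Ideal (𝓞 K) // (𝔟 * J).IsPrincipal}, G J.1) =
      ∑' J : ↥{J : Ideal (𝓞 K) | (𝔟 * J).IsPrincipal}, G J from rfl, tsum_subtype]
  refine tsum_congr fun J ↦ ?_
  by_cases hJ : J = ⊥
  · subst hJ
    simp [Set.indicator, hG0]
  · by_cases h : (𝔟 * J).IsPrincipal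
    · rw [Set.indicator_of_mem (show J ∈ {J | (𝔟 * J).IsPrincipal} from h),
        if_pos ((mul_isPrincipal_iff_idealClass_eq h𝔟 hJ).1 h)]
    · rw [Set.indicator_of_notMem (show J ∉ {J | (𝔟 * J).IsPrincipal} from h), if_neg]
      exact fun h' ↦ h ((mul_isPrincipal_iff_idealClass_eq h𝔟 hJ).2 h')

open scoped Classical in
/-- **Orthogonality of the class characters inside a sum over ideals**: for a summable `G`,
`∑_{[J] = C₀} G(J) = (1/h) ∑_χ χ(C₀)⁻¹ ∑_J χ([J]) G(J)`. (D–H I §4: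
"`ζ(s, Q) = (2/h(d)) ∑_χ χ̄(𝔎₁) L(s, χ)`".) [cite: DavenportHeilbronn1936a, §4] -/
theorem tsum_indicator_idealClass_eq_sum_addChar (C₀ : ClassGroup (𝓞 K)) {G : Ideal (𝓞 K) → ℂ}
    (hG : Summable G) :
    ∑' J : Ideal (𝓞 K), (if idealClass J = C₀ then G J else 0) =
      (1 / (Nat.card (ClassGroup (𝓞 K)) : ℂ)) *
        ∑ χ : AddChar (Additive (ClassGroup (𝓞 K))) ℂ,
          (χ (Additive.ofMul C₀))⁻¹ * ∑' J : Ideal (𝓞 K), toMulHom χ (idealClass J) * G J := by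
  have hcard : (Nat.card (ClassGroup (𝓞 K)) : ℂ) ≠ 0 := Nat.cast_ne_zero.mpr Nat.card_pos.ne'
  -- summability of the twisted sums
  have hsum : ∀ χ : AddChar (Additive (ClassGroup (𝓞 K))) ℂ,
      Summable fun J : Ideal (𝓞 K) ↦ toMulHom χ (idealClass J) * G J := by
    intro χ
    refine Summable.of_norm_bounded hG.norm fun J ↦ ?_
    rw [norm_mul, norm_toMulHom, one_mul]
  -- pull the finite sum inside
  have h1 : ∑ χ : AddChar (Additive (ClassGroup (𝓞 K))) ℂ,
      (χ (Additive.ofMul C₀))⁻¹ * ∑' J : Ideal (𝓞 K), toMulHom χ (idealClass J) * G J =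
      ∑' J : Ideal (𝓞 K), ∑ χ : AddChar (Additive (ClassGroup (𝓞 K))) ℂ,
        (χ (Additive.ofMul C₀))⁻¹ * (toMulHom χ (idealClass J) * G J) := by
    rw [Summable.tsum_finsetSum (fun χ _ ↦ (hsum χ).mul_left _)]
    exact Finset.sum_congr rfl fun χ _ ↦ (tsum_mul_left).symm
  have h2 : ∀ J : Ideal (𝓞 K), ∑ χ : AddChar (Additive (ClassGroup (𝓞 K))) ℂ,
      (χ (Additive.ofMul C₀))⁻¹ * (toMulHom χ (idealClass J) * G J) =
        if idealClass J = C₀ then (Nat.card (ClassGroup (𝓞 K)) : ℂ) * G J else 0 := by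
    intro J
    simp_rw [← mul_assoc]
    rw [← Finset.sum_mul, sum_char_inv_mul C₀ (idealClass J)]
    split_ifs <;> simp
  rw [h1]
  simp only [h2]
  rw [← tsum_mul_left]
  refine tsum_congr fun J ↦ ?_
  split_ifs
  · field_simp
  · rw [mul_zero]

/-! ## The twisted class-character `L`-series `M(s, χ)` -/

/-- `M(s, χ) = ∑_𝔞 χ([𝔞]) a(N𝔞) N𝔞^{-s}` is the tree's `rayClassLSeries ⊤ (twistCoeff χ a)` (whose
coefficient at `𝔞 ≠ 0` is the multiplicative extension `χ([𝔞]) a(N𝔞)` of `twistCoeff`, and whose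
term at `𝔞 = 0` vanishes), `Re s > 1`. [cite: DavenportHeilbronn1936a, §2 and §4] -/
theorem rayClassLSeries_twistCoeff_eq_tsum (χ : AddChar (Additive (ClassGroup (𝓞 K))) ℂ) (a : ℕ →* ℂ)
    {s : ℂ} (hs : s ≠ 0) :
    rayClassLSeries ⊤ (twistCoeff χ a) s =
      ∑' J : Ideal (𝓞 K), toMulHom χ (idealClass J) * (a (absNorm J) * ((absNorm J : ℕ) : ℂ) ^ (-s)) := by
  classical
  unfold rayClassLSeries
  refine tsum_congr fun J ↦ ?_
  by_cases hJ : J = ⊥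
  · subst hJ
    rw [rayClassCoeff_bot]
    simp [Complex.zero_cpow (neg_ne_zero.mpr hs)]
  · have hcop : IsCoprime J (⊤ : Ideal (𝓞 K)) := ⟨0, 1, by simp⟩
    rw [rayClassCoeff, if_pos ⟨hJ, hcop⟩, idealPow_twistCoeff χ a hJ]
    ring

omit [NumberField K] in
/-- The modulus `(1) = ⊤` excludes no prime: `ψ' = ψ` for `𝔪 = ⊤`. [folklore] -/
theorem rayClassPrimeValue_top (ψ : HeightOneSpectrum (𝓞 K) → ℂ) :
    rayClassPrimeValue ⊤ ψ = ψ := by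
  funext v
  unfold rayClassPrimeValue
  rw [if_neg (fun h ↦ v.isPrime.ne_top (top_le_iff.1 h))]

/-- **`M(s, χ) = exp E_χ(s)`**, `E_χ = logEuler (twistCoeff χ a)` (the Euler product
"`M(s, χ) = ∏_p {1 − a(p)χ(p) p^{-s}}⁻¹`" of D–H I §2, through its logarithm), for real `s > 1` and
`|a| ≤ 1`. [cite: DavenportHeilbronn1936a, §2] -/
theorem cexp_logEuler_twistCoeff (χ : AddChar (Additive (ClassGroup (𝓞 K))) ℂ) {a : ℕ → ℂ}
    (ha : ∀ n, ‖a n‖ ≤ 1) {s : ℝ} (hs : 1 < s) :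
    cexp (logEuler (twistCoeff χ a) s) = rayClassLSeries ⊤ (twistCoeff χ a) (s : ℂ) := by
  have hψ := norm_twistCoeff_le' ⊤ χ ha
  have h1 := hasProd_cexp_logEuler (norm_twistCoeff_le χ ha) hs
  have h2 := hasProd_rayClassLSeries_rayClassPrimeValue top_ne_bot hψ (s := (s : ℂ)) (by simpa using hs)
  rw [rayClassPrimeValue_top] at h2
  have h3 : HasProd (fun v : HeightOneSpectrum (𝓞 K) ↦ (1 - zterm (twistCoeff χ a) s v)⁻¹)
      (rayClassLSeries ⊤ (twistCoeff χ a) (s : ℂ)) := by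
    refine h2.congr_fun fun v ↦ ?_
    unfold zterm npow
    congr 3
    rw [Complex.ofReal_cpow (Nat.cast_nonneg _) (-s)]
    push_cast
    rfl
  exact h1.unique h3

/-! ## The bridge -/

omit [NumberField K] in
/-- `χ([𝔟]⁻¹)⁻¹ = χ([𝔟])`. [folklore] -/
theorem addChar_ofMul_inv_inv (χ : AddChar (Additive (ClassGroup (𝓞 K))) ℂ) (g : ClassGroup (𝓞 K)) :
    (χ (Additive.ofMul g⁻¹))⁻¹ = toMulHom χ g := by
  rw [ofMul_inv, AddChar.map_neg_eq_inv, inv_inv, toMulHom_apply]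

/-- **The bridge: `Z_a(s) = (2/h) ∑_χ χ([𝔟]) exp E_χ(s)`.** For an imaginary quadratic field with
`d_K < −4`, integral basis `(1, ω)` (`ω² = m + tω`), the lattice ideal `𝔟 = (A, ω − k)` of the form
`Q = (A, t − 2k, C)` (`A > 0`, `AC = k² − tk − m`), a completely multiplicative `a : ℕ →* ℂ` with
`|a| ≤ 1`, and real `s > 1`: the twisted model of `Q` is
`Σ'_v a(Q(v)) Q(v)^{-s} = (2/h) ∑_χ χ([𝔟]) · exp (logEuler (twistCoeff χ a) s)`, the sum over the
characters `χ` of `Cl(K)` (D–H I §4 "`ζ(s, Q) = (2/h(d)) ∑_χ χ̄(𝔎₁) L(s, χ)`", twisted as in §2; the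
class of `Q` is `𝔎₁ = [𝔟]⁻¹`). [cite: DavenportHeilbronn1936a, §2 and §4] -/
theorem twistModel_eq_sum_addChar (b : Basis (Fin 2) ℤ (𝓞 K)) (hb : b 0 = 1)
    {t m : ℤ} (hω : b 1 * b 1 = (m : 𝓞 K) + (t : 𝓞 K) * b 1) (hD : t ^ 2 + 4 * m < -4)
    {A k C : ℤ} (hA : 0 < A) (hn : A * C = k ^ 2 - t * k - m)
    (a : ℕ →* ℂ) (ha : ∀ n, ‖a n‖ ≤ 1) {s : ℝ} (hs : 1 < s) :
    twistModel a A (t - 2 * k) C (s : ℂ) =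
      (2 / (Nat.card (ClassGroup (𝓞 K)) : ℂ)) * ∑ χ : AddChar (Additive (ClassGroup (𝓞 K))) ℂ,
        toMulHom χ (idealClass (span {(A : 𝓞 K), b 1 - k})) * cexp (logEuler (twistCoeff χ a) s) := by
  classical
  have hs' : 1 < ((s : ℂ)).re := by simpa using hs
  have hs0 : (s : ℂ) ≠ 0 := fun h ↦ by rw [h, Complex.zero_re] at hs'; linarith
  set 𝔟 : Ideal (𝓞 K) := span {(A : 𝓞 K), b 1 - k} with h𝔟
  have h𝔟0 : 𝔟 ≠ ⊥ := by
    intro h0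
    have hmem : (A : 𝓞 K) ∈ 𝔟 := Ideal.subset_span (by simp)
    rw [h0] at hmem
    have h1 : (A : 𝓞 K) = 0 := by simpa using hmem
    exact hA.ne' (intCast_eq_zero_of_basis b hb h1)
  -- the class sum
  have hclass := tsum_ideal_mul_isPrincipal_eq_half_twistModel b hb hω hD hA hn a ha hs'
  set G : Ideal (𝓞 K) → ℂ := fun J ↦ a (absNorm J) * ((absNorm J : ℕ) : ℂ) ^ (-(s : ℂ)) with hG
  have hG0 : G ⊥ = 0 := by
    simp only [hG, Ideal.absNorm_bot, Nat.cast_zero, Complex.zero_cpow (neg_ne_zero.mpr hs0), mul_zero]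
  have hGsum : Summable G := by
    refine Summable.of_norm_bounded (summable_norm_absNorm_cpow K hs') fun J ↦ ?_
    rw [hG, norm_mul]
    exact mul_le_of_le_one_left (norm_nonneg _) (ha _)
  have h1 : ∑' J : {J : Ideal (𝓞 K) // (𝔟 * J).IsPrincipal}, a (absNorm J.1) * ((absNorm J.1 : ℕ) : ℂ) ^ (-(s : ℂ))
      = ∑' J : Ideal (𝓞 K), if idealClass J = (idealClass 𝔟)⁻¹ then G J else 0 :=
    tsum_subtype_mul_isPrincipal_eq h𝔟0 hG0
  rw [h1, tsum_indicator_idealClass_eq_sum_addChar _ hGsum] at hclass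
  -- identify the twisted sums with `exp E_χ`
  have h2 : ∀ χ : AddChar (Additive (ClassGroup (𝓞 K))) ℂ,
      ∑' J : Ideal (𝓞 K), toMulHom χ (idealClass J) * G J = cexp (logEuler (twistCoeff χ a) s) := by
    intro χ
    rw [cexp_logEuler_twistCoeff χ ha hs, rayClassLSeries_twistCoeff_eq_tsum χ a hs0]
  simp only [h2, addChar_ofMul_inv_inv] at hclass
  -- solve for the model
  linear_combination (-2 : ℂ) * hclass

end DHEpstein

end Literature.Barriers.RiemannHypothesis
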